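import Literature.IUT.HodgeTheaters.DiscreteProfiniteConjugatesSurfaceHCS
import Literature.GroupTheory.CombinatorialGroupTheory.SurfaceGroupConjugacySeparable
import Literature.IUT.HodgeTheaters.SurfaceGroupBridge
import HarnessLib

/-!
# [IUTchI] Thm 2.6 / Cor 2.8 / Lem 2.7 (vi)(vii), orientable-surface halves: plugging in the named
# facts [Stb2] + Riemann–Hurwitz and finite generation

Mochizuki, *Inter-universal Teichmüller theory I*, kurims manuscript (May 2020), §2, Theorem 2.6 p. 56,
Lemma 2.7 p. 57, Corollary 2.8 p. 59 [cite: Mochizuki2012, Thm 2.6 pp.56-59] (D-0012 claim key; series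
status DISPUTED — classical group theory here; Remark 2.8.1: the surface case is off the IUT route).

`DiscreteProfiniteConjugatesSurfaceHCS.lean` reduces the orientable-surface halves of the four named
statements to properties (HCS), (III), (Z), (IV), (FG) of orientable surface groups.  This file
DISCHARGES (FG) (an orientable surface group is finitely generated — it is a quotient of the free group on
the `2g` letters `Fin g ⊕ Fin g`) and derives (HCS) from the two NAMED FACTS of
`Literature/GroupTheory/CombinatorialGroupTheory/SurfaceGroupConjugacySeparable.lean` —
`SurfaceGroupConjugacySeparable` ([Stb2] = Stebe 1972 Thm 3.3, cited [IUTchI] p. 57 l. 9) and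
`SurfaceGroupFiniteIndexSubgroup` (Riemann–Hurwitz, ZVC 1980 Thm 4.14.22 / Prop 4.14.23) — via the
identification of every orientable surface group (the predicate `IsOrientableSurfaceGroup` of
`DiscreteProfiniteConjugates.lean`, built on the presentation over `Fin g ⊕ Fin g`) with the tree's
`Literature.Topology.FourManifolds.SurfaceGroup g` (presentation over `Fin g × Bool`):
abc-iut-L5-d1's `exists_mulEquiv_surfaceGroup` (`SurfaceGroupBridge.lean`).  Result: the named
statements `ProfiniteConjugatesOfDiscreteSubgroups` (Thm 2.6), `SubgroupsOfComplexHyperbolicPi1` (Cor 2.8),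
`FreeOrSurface.centralizerCommutatorKernelTrivial` (Lem 2.7 (vi)), `FreeOrSurface.autFixingCommutatorKernelTrivial`
(Lem 2.7 (vii)) hold MODULO: the two named facts and the orientable-surface halves of
Lemma 2.7 (iii) (III), of "centralizers of non-trivial elements are cyclic" (Z) and — for Thm 2.6 / Cor 2.8
— of Lemma 2.7 (iv) (IV) (abc-iut-L5-d1's lane).  Proof-only file; typed ≠ discharged; nothing restated.
-/

namespace Literature.IUT.HodgeTheaters

open scoped Pointwise
open Literature.GroupTheory.CombinatorialGroupTheory (SurfaceGroupConjugacySeparable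
  SurfaceGroupFiniteIndexSubgroup two_le_genus_of_index)

universe u

namespace FreeOrSurface

/-! ### (FG): orientable surface groups are finitely generated -/

/-- The surface group of genus `g` (presentation over the finite alphabet `Fin g ⊕ Fin g`) is finitely
generated. [cite: Mochizuki2012, Thm 2.6 p.56] -/
theorem fg_surfaceGroup (g : ℕ) : Group.FG (SurfaceGroup g) :=
  Group.fg_of_surjective (PresentedGroup.mk_surjective _)

/-- **(FG)** An orientable surface group is finitely generated. [cite: Mochizuki2012, Thm 2.6 p.56] -/
theorem fg_of_isOrientableSurfaceGroup (G : Type u) [Group G] (hG : IsOrientableSurfaceGroup G) :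
    Group.FG G := by
  obtain ⟨g, -, ⟨e⟩⟩ := hG
  haveI := fg_surfaceGroup g
  exact Group.fg_of_surjective (f := e.symm.toMonoidHom) e.symm.surjective

/-! ### (HCS) from the named facts [Stb2] + Riemann–Hurwitz, via the bridge to `FourManifolds.SurfaceGroup` -/

/-- An orientable surface group is isomorphic to some `FourManifolds.SurfaceGroup g`, `g ≥ 2`
(abc-iut-L5-d1's bridge `exists_mulEquiv_surfaceGroup` between the two presentations of the tree).
[cite: Mochizuki2012, Thm 2.6 p.56] -/
theorem exists_mulEquiv_fourManifoldsSurfaceGroup (S : Type u) [Group S] (hS : IsOrientableSurfaceGroup S) :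
    ∃ g : ℕ, 2 ≤ g ∧ Nonempty (S ≃* Literature.Topology.FourManifolds.SurfaceGroup g) := by
  obtain ⟨g, hg, ⟨e₁⟩⟩ := hS
  obtain ⟨e₂⟩ := exists_mulEquiv_surfaceGroup g
  exact ⟨g, hg, ⟨e₁.trans e₂⟩⟩

/-- **(HCS) from the named facts.**  GIVEN Stebe's theorem (`SurfaceGroupConjugacySeparable`) and the
Riemann–Hurwitz description of finite-index subgroups (`SurfaceGroupFiniteIndexSubgroup`), every
finite-index subgroup of an orientable surface group is conjugacy separable ("`G` is conjugacy
separable … [Stb2], Theorem 3.3", p. 57, applied to the finite-index subgroups `G₁` of p. 57).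
[cite: Mochizuki2012, Thm 2.6 p.57] -/
theorem hcs_of_surfaceFacts (hCS : SurfaceGroupConjugacySeparable) (hFI : SurfaceGroupFiniteIndexSubgroup)
    (S : Type u) [Group S] (hS : IsOrientableSurfaceGroup S) (K : Subgroup S) [K.FiniteIndex] :
    ∀ u v : K, ¬ IsConj u v → ∃ (L : Subgroup K) (_ : L.Normal) (_ : L.FiniteIndex),
      ¬ IsConj (QuotientGroup.mk u : K ⧸ L) (QuotientGroup.mk v) := by
  obtain ⟨g, hg, ⟨e⟩⟩ := exists_mulEquiv_fourManifoldsSurfaceGroup S hS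
  -- `K ≅ e(K)`, a finite-index subgroup of `S_g`, which is `≅ S_h` with `h ≥ 2`
  let K' : Subgroup (Literature.Topology.FourManifolds.SurfaceGroup g) := K.map e.toMonoidHom
  haveI hK' : K'.FiniteIndex := by
    constructor
    change (K.map e.toMonoidHom).index ≠ 0
    rw [Subgroup.index_map_of_bijective e.bijective]
    exact Subgroup.FiniteIndex.index_ne_zero
  obtain ⟨h, hh, ⟨f⟩⟩ := hFI g hg K' hK'
  have h2 : 2 ≤ h := two_le_genus_of_index hg Subgroup.FiniteIndex.index_ne_zero hh
  have eK : K ≃* K' := Subgroup.equivMapOfInjective K e.toMonoidHom e.injective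
  exact ProfiniteCompletion.conjSeparable_of_mulEquiv (eK.trans f) (hCS h h2)

/-! ### The named statements modulo the named facts, the bridge, (III), (Z) [, (IV)] -/

/-- **Theorem 2.6 (the named statement) modulo [Stb2] + Riemann–Hurwitz + the surface halves
of Lemma 2.7 (iii), (iv) and cyclic centralizers.** [cite: Mochizuki2012, Thm 2.6 pp.56-57] -/
theorem profiniteConjugatesOfDiscreteSubgroups_of_surfaceFacts
    (hCS : SurfaceGroupConjugacySeparable) (hFI : SurfaceGroupFiniteIndexSubgroup)
    (hIII : ∀ (S : Type u) [Group S], IsOrientableSurfaceGroup S → ∀ x y : S, x * y ≠ y * x →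
      ∃ (S₁ : Subgroup S) (n : ℕ) (hx : x ^ n ∈ S₁) (hy : y ^ n ∈ S₁), S₁.FiniteIndex ∧ 0 < n ∧
        ∀ i j : ℤ, Abelianization.of (⟨x ^ n, hx⟩ : S₁) ^ i *
          Abelianization.of (⟨y ^ n, hy⟩ : S₁) ^ j = 1 → i = 0 ∧ j = 0)
    (hZ : ∀ (S : Type u) [Group S], IsOrientableSurfaceGroup S → ∀ u : S, u ≠ 1 →
      IsCyclic (Subgroup.centralizer ({u} : Set S)))
    (hIV : ∀ (S : Type u) [Group S], IsOrientableSurfaceGroup S →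
      ∀ J : Subgroup S, (∀ a ∈ J, ∀ b ∈ J, a * b = b * a) → IsCyclic J) :
    ProfiniteConjugatesOfDiscreteSubgroups.{u} :=
  profiniteConjugatesOfDiscreteSubgroups_of_surfaceHCS
    (fun S _ hS K hK => by haveI := hK; exact hcs_of_surfaceFacts hCS hFI S hS K)
    hIII hZ hIV fg_of_isOrientableSurfaceGroup

/-- **Corollary 2.8 (the named statement) modulo the same inputs.** [cite: Mochizuki2012, Cor 2.8 p.59] -/
theorem subgroupsOfComplexHyperbolicPi1_of_surfaceFacts
    (hCS : SurfaceGroupConjugacySeparable) (hFI : SurfaceGroupFiniteIndexSubgroup)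
    (hIII : ∀ (S : Type u) [Group S], IsOrientableSurfaceGroup S → ∀ x y : S, x * y ≠ y * x →
      ∃ (S₁ : Subgroup S) (n : ℕ) (hx : x ^ n ∈ S₁) (hy : y ^ n ∈ S₁), S₁.FiniteIndex ∧ 0 < n ∧
        ∀ i j : ℤ, Abelianization.of (⟨x ^ n, hx⟩ : S₁) ^ i *
          Abelianization.of (⟨y ^ n, hy⟩ : S₁) ^ j = 1 → i = 0 ∧ j = 0)
    (hZ : ∀ (S : Type u) [Group S], IsOrientableSurfaceGroup S → ∀ u : S, u ≠ 1 →
      IsCyclic (Subgroup.centralizer ({u} : Set S)))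
    (hIV : ∀ (S : Type u) [Group S], IsOrientableSurfaceGroup S →
      ∀ J : Subgroup S, (∀ a ∈ J, ∀ b ∈ J, a * b = b * a) → IsCyclic J) :
    SubgroupsOfComplexHyperbolicPi1.{u} :=
  subgroupsOfComplexHyperbolicPi1_of_thm26
    (profiniteConjugatesOfDiscreteSubgroups_of_surfaceFacts hCS hFI hIII hZ hIV)

/-- **Lemma 2.7 (vi) (the named statement) modulo [Stb2] + Riemann–Hurwitz + the surface halves
of Lemma 2.7 (iii) and cyclic centralizers.** [cite: Mochizuki2012, Lem 2.7(vi) pp.58-59] -/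
theorem centralizerCommutatorKernelTrivial_of_surfaceFacts
    (hCS : SurfaceGroupConjugacySeparable) (hFI : SurfaceGroupFiniteIndexSubgroup)
    (hIII : ∀ (S : Type u) [Group S], IsOrientableSurfaceGroup S → ∀ x y : S, x * y ≠ y * x →
      ∃ (S₁ : Subgroup S) (n : ℕ) (hx : x ^ n ∈ S₁) (hy : y ^ n ∈ S₁), S₁.FiniteIndex ∧ 0 < n ∧
        ∀ i j : ℤ, Abelianization.of (⟨x ^ n, hx⟩ : S₁) ^ i *
          Abelianization.of (⟨y ^ n, hy⟩ : S₁) ^ j = 1 → i = 0 ∧ j = 0)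
    (hZ : ∀ (S : Type u) [Group S], IsOrientableSurfaceGroup S → ∀ u : S, u ≠ 1 →
      IsCyclic (Subgroup.centralizer ({u} : Set S))) :
    centralizerCommutatorKernelTrivial.{u} :=
  centralizerCommutatorKernelTrivial_of_surfaceHCS
    (fun S _ hS K hK => by haveI := hK; exact hcs_of_surfaceFacts hCS hFI S hS K)
    hIII hZ fg_of_isOrientableSurfaceGroup

/-- **Lemma 2.7 (vii) (the named statement) modulo the same inputs as (vi).**
[cite: Mochizuki2012, Lem 2.7(vii) p.59] -/
theorem autFixingCommutatorKernelTrivial_of_surfaceFacts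
    (hCS : SurfaceGroupConjugacySeparable) (hFI : SurfaceGroupFiniteIndexSubgroup)
    (hIII : ∀ (S : Type u) [Group S], IsOrientableSurfaceGroup S → ∀ x y : S, x * y ≠ y * x →
      ∃ (S₁ : Subgroup S) (n : ℕ) (hx : x ^ n ∈ S₁) (hy : y ^ n ∈ S₁), S₁.FiniteIndex ∧ 0 < n ∧
        ∀ i j : ℤ, Abelianization.of (⟨x ^ n, hx⟩ : S₁) ^ i *
          Abelianization.of (⟨y ^ n, hy⟩ : S₁) ^ j = 1 → i = 0 ∧ j = 0)
    (hZ : ∀ (S : Type u) [Group S], IsOrientableSurfaceGroup S → ∀ u : S, u ≠ 1 →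
      IsCyclic (Subgroup.centralizer ({u} : Set S))) :
    autFixingCommutatorKernelTrivial.{u} :=
  autFixingCommutatorKernelTrivial_of_centralizer
    (centralizerCommutatorKernelTrivial_of_surfaceFacts hCS hFI hIII hZ)

end FreeOrSurface

end Literature.IUT.HodgeTheaters
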